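import Literature.Barriers.CriticalPhenomena.LongRangeTrivialityOnZ3TwoPoint
import Literature.Probability.LatticeModels.WeightedTreeBoundCorrelations

/-!
# Discharge of `panis_treeDiagramBound`: Aizenman's tree diagram bound for long-range pair interactions

Sibling of `Literature/Barriers/CriticalPhenomena/LongRangeTrivialityOnZ3TwoPoint.lean` (barrier catalogue
D-0021, sub-problem `Ising3DConformalLimit`), which vendors as the named fact `panis_treeDiagramBound` the
tree diagram bound "`|U₄^β(x,y,z,t)| ≤ 2 ∑_{u∈ℤ^d} ⟨σ_xσ_u⟩_β ⟨σ_yσ_u⟩_β ⟨σ_zσ_u⟩_β ⟨σ_tσ_u⟩_β`" (Panis 2023,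
arXiv:2309.05797, §4.2, display following Proposition 4.7, after Aizenman 1982) for the couplings
`J_{x,y} = C₀|x-y|₁^{-d-α}` and `0 < β ≤ β_c`, in the infinite-volume state `LongRangeIsing.state` (box limit of
the free finite-volume states `LongRangeIsing.expectIn`).

This file PROVES it (`panis_treeDiagramBound_holds`), for every ferromagnetic pair interaction `J ≥ 0` on
`ℤ^d` and every `β ≥ 0` (`LongRangeIsing.treeDiagramBound_state`; neither `β ≤ β_c` nor the algebraic
form of `J` is used):

* `LongRangeIsing.expectIn_spinProduct_eq_wcurrentSum_div` — the finite-volume free state of `Λ` is the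
  weighted random-current ratio `Z_K[A]/Z_K[∅]` on the complete graph of `↥Λ` with couplings
  `K_{{a,b}} = β(J_{a,b}+J_{b,a})/2` (`Literature.Probability.LatticeModels.pairEdgeWeight`; the diagonal terms
  and the symmetrisation of `-βH_{Λ,J,0} = (β/2)∑_{x,y∈Λ}J_{x,y}σ_xσ_y` are handled by
  `Literature.Probability.LatticeModels.pairGibbs_spinProduct_eq_wcurrentSum_div`);
* `LongRangeIsing.abs_ursellFour_expectIn_le` — the finite-volume tree diagram bound, from the weighted
  random-current theorem `Literature.Probability.LatticeModels.abs_ursell_ratio_le` (switching lemma,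
  conditioning on the cluster of `x`, Simon-type restricted-volume bound;
  `Literature/Probability/LatticeModels/WeightedTreeBound*.lean`);
* `LongRangeIsing.treeDiagramBound_state` — the box limit: the finite-volume `U₄` converges
  (`tendsto_expectIn_box` on the four spin products), each finite-volume two-point function is dominated by
  its infinite-volume limit (`expectIn_le_state`, Griffiths II) and finite partial sums by the `ℝ≥0∞` series.

## References

* R. Panis, arXiv:2309.05797 (2023) = Ann. Probab. 54 (2026): §4.1 (Definition 4.1, Lemma 4.4, the
  random-current representation of `⟨σ_A⟩_{Λ,β}`), §4.2 (Proposition 4.7 and the tree diagram bound)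
  [Panis2023Triviality] (held; read pp. 19–20).
* M. Aizenman, Comm. Math. Phys. 86 (1982) [Aizenman1982].
-/

noncomputable section

namespace Literature.Barriers.CriticalPhenomena

open Literature.Probability.LatticeModels Literature.Probability.Percolation Filter Finset
open _root_.Topology
open scoped symmDiff ENNReal

namespace LongRangeIsing

variable {d : ℕ} (J : Site d → Site d → ℝ) (β : ℝ)

/-! ### The finite-volume free state as weighted random currents on the complete graph of `↥Λ` -/

/-- The zero-field Gibbs weight is the pair-interaction Boltzmann weight of the finite type `↥Λ`:
`e^{-βH_{Λ,J,0}(τ·free)} = exp((β/2)∑_{a,b∈Λ} J_{a,b} τ_aτ_b)`. [cite: Panis2023Triviality, §1.2.1 (H_{Λ,J,h})] -/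
theorem pairGibbsWeight_zero_eq (Λ : Finset (Site d)) (τ : SpinConfig ↥Λ) :
    pairGibbsWeight J Λ β 0 τ =
      Real.exp (β / 2 * ∑ a : ↥Λ, ∑ b : ↥Λ, J a b * spinAt a τ * spinAt b τ) := by
  rw [pairGibbsWeight, pairHamiltonian, zero_mul, sub_zero]
  congr 1
  rw [← Finset.sum_coe_sort Λ]
  simp_rw [← Finset.sum_coe_sort Λ (fun y => J _ y * spinAt _ (glue Λ τ .free) * spinAt y (glue Λ τ .free)),
    spinAt_glue_coe]
  ring

/-- The trace of a singleton inside the volume (cf. the tree's `inVol_symmDiff`). [folklore] -/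
theorem inVol_singleton {Λ : Finset (Site d)} {x : Site d} (hx : x ∈ Λ) : inVol Λ {x} = {⟨x, hx⟩} := by
  ext v
  simp only [mem_inVol, Finset.mem_singleton, Subtype.ext_iff]

/-- The trace of a pair `{x} Δ {y}` with `x, y ∈ Λ`. [folklore] -/
theorem inVol_pair {Λ : Finset (Site d)} {x y : Site d} (hx : x ∈ Λ) (hy : y ∈ Λ) :
    inVol Λ ({x} ∆ {y}) = {⟨x, hx⟩} ∆ {⟨y, hy⟩} := by
  rw [inVol_symmDiff, inVol_singleton hx, inVol_singleton hy]

/-- **The finite-volume free state as random-current ratios** (Panis 2023, §4.1: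
`⟨σ_A⟩_{Λ,β} = ∑_{∂n=A}w_β(n)/∑_{∂n=∅}w_β(n)`, `w_β(n) = ∏(βJ_{x,y})^{n_{x,y}}/n_{x,y}!`): for `β ≥ 0`,
`J ≥ 0`, `⟨σ_A⟩_{Λ,J,0,β} = Z_K[A ∩ Λ]/Z_K[∅]` on the complete graph of `↥Λ` with `K = pairEdgeWeight J β`.
[cite: Panis2023Triviality, §4.1] -/
theorem expectIn_spinProduct_eq_wcurrentSum_div (hβ : 0 ≤ β) (hJ : ∀ x y, 0 ≤ J x y) (Λ A : Finset (Site d)) :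
    expectIn J Λ β 0 (spinProduct A) =
      wcurrentSum (pairEdgeWeight (fun a b : ↥Λ => J a b) β) (inVol Λ A) /
        wcurrentSum (pairEdgeWeight (fun a b : ↥Λ => J a b) β) ∅ := by
  rw [← pairGibbs_spinProduct_eq_wcurrentSum_div (J := fun a b : ↥Λ => J a b) hβ (fun a b => hJ a b) (inVol Λ A),
    expectIn]
  simp_rw [pairGibbsWeight_zero_eq, spinProduct_glue_free]

/-! ### The finite-volume tree diagram bound -/

/-- **Aizenman's tree diagram bound in finite volume** (Aizenman 1982; Panis 2023, §4.2, "the proof is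
valid on any graph and thus remains valid in the case of general interactions"): for `β ≥ 0`, `J ≥ 0`,
a finite `Λ ⊆ ℤ^d` and `x, y, z, t ∈ Λ`, with `⟨·⟩ = ⟨·⟩_{Λ,J,0,β}` and spin products `σ_{{a}Δ{b}}`,
`|⟨σ_xσ_yσ_zσ_t⟩ - ⟨σ_xσ_y⟩⟨σ_zσ_t⟩ - ⟨σ_xσ_z⟩⟨σ_yσ_t⟩ - ⟨σ_xσ_t⟩⟨σ_yσ_z⟩| ≤ 2∑_{u∈Λ} ⟨σ_xσ_u⟩⟨σ_yσ_u⟩⟨σ_zσ_u⟩⟨σ_tσ_u⟩`.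
[cite: Panis2023Triviality, §4.2 (tree diagram bound, display after Proposition 4.7)] -/
theorem abs_ursellFour_expectIn_le (hβ : 0 ≤ β) (hJ : ∀ x y, 0 ≤ J x y) {Λ : Finset (Site d)}
    {x y z t : Site d} (hx : x ∈ Λ) (hy : y ∈ Λ) (hz : z ∈ Λ) (ht : t ∈ Λ) :
    |expectIn J Λ β 0 (spinProduct ({x} ∆ ({y} ∆ ({z} ∆ {t})))) -
        expectIn J Λ β 0 (spinProduct ({x} ∆ {y})) * expectIn J Λ β 0 (spinProduct ({z} ∆ {t})) -
        expectIn J Λ β 0 (spinProduct ({x} ∆ {z})) * expectIn J Λ β 0 (spinProduct ({y} ∆ {t})) -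
        expectIn J Λ β 0 (spinProduct ({x} ∆ {t})) * expectIn J Λ β 0 (spinProduct ({y} ∆ {z}))| ≤
      2 * ∑ u ∈ Λ, expectIn J Λ β 0 (spinProduct ({x} ∆ {u})) * expectIn J Λ β 0 (spinProduct ({y} ∆ {u})) *
        expectIn J Λ β 0 (spinProduct ({z} ∆ {u})) * expectIn J Λ β 0 (spinProduct ({t} ∆ {u})) := by
  set K := pairEdgeWeight (fun a b : ↥Λ => J a b) β with hKdef
  have hK : ∀ e, 0 ≤ K e := pairEdgeWeight_nonneg hβ fun a b => hJ a b
  have hE : ∀ A, expectIn J Λ β 0 (spinProduct A) = wcurrentSum K (inVol Λ A) / wcurrentSum K ∅ :=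
    fun A => expectIn_spinProduct_eq_wcurrentSum_div J β hβ hJ Λ A
  have h4 : inVol Λ ({x} ∆ ({y} ∆ ({z} ∆ {t}))) = {⟨x, hx⟩} ∆ ({⟨y, hy⟩} ∆ ({⟨z, hz⟩} ∆ {⟨t, ht⟩})) := by
    rw [inVol_symmDiff, inVol_symmDiff, inVol_symmDiff, inVol_singleton hx, inVol_singleton hy,
      inVol_singleton hz, inVol_singleton ht]
  have hsum : ∑ u ∈ Λ, expectIn J Λ β 0 (spinProduct ({x} ∆ {u})) * expectIn J Λ β 0 (spinProduct ({y} ∆ {u})) *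
      expectIn J Λ β 0 (spinProduct ({z} ∆ {u})) * expectIn J Λ β 0 (spinProduct ({t} ∆ {u})) =
      ∑ u : ↥Λ, wcurrentSum K ({⟨x, hx⟩} ∆ {u}) / wcurrentSum K ∅ * (wcurrentSum K ({⟨y, hy⟩} ∆ {u}) / wcurrentSum K ∅) *
        (wcurrentSum K ({⟨z, hz⟩} ∆ {u}) / wcurrentSum K ∅) * (wcurrentSum K ({⟨t, ht⟩} ∆ {u}) / wcurrentSum K ∅) := by
    rw [← Finset.sum_coe_sort Λ]
    refine Finset.sum_congr rfl fun u _ => ?_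
    rw [hE, hE, hE, hE, inVol_pair hx u.2, inVol_pair hy u.2, inVol_pair hz u.2, inVol_pair ht u.2]
  rw [hE, hE, hE, hE, hE, hE, hE, h4, inVol_pair hx hy, inVol_pair hz ht, inVol_pair hx hz, inVol_pair hy ht,
    inVol_pair hx ht, inVol_pair hy hz, hsum]
  exact abs_ursell_ratio_le hK ⟨x, hx⟩ ⟨y, hy⟩ ⟨z, hz⟩ ⟨t, ht⟩

/-! ### The box limit -/

/-- `σ_xσ_yσ_zσ_t = σ_{{x}Δ{y}Δ{z}Δ{t}}` (`σ_u² = 1`). [folklore] -/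
theorem spinAt_mul_four_eq_spinProduct (x y z t : Site d) (σ : SpinConfig (Site d)) :
    spinAt x σ * spinAt y σ * spinAt z σ * spinAt t σ = spinProduct ({x} ∆ ({y} ∆ ({z} ∆ {t}))) σ := by
  have ht : spinProduct {t} σ = spinAt t σ := by simp [spinProduct]
  rw [spinProduct_singleton_symmDiff, spinProduct_singleton_symmDiff, spinProduct_singleton_symmDiff, ht]
  ring

/-- The four-point function is the state of a spin product. [folklore] -/
theorem fourCorrelation_eq (x y z t : Site d) :
    fourCorrelation J β x y z t = state J β 0 (spinProduct ({x} ∆ ({y} ∆ ({z} ∆ {t})))) := by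
  rw [fourCorrelation]
  congr 1
  funext σ
  exact spinAt_mul_four_eq_spinProduct x y z t σ

/-- **Aizenman's tree diagram bound for the infinite-volume free state of a ferromagnetic pair interaction
on `ℤ^d`** (Aizenman 1982; Panis 2023, §4.2, display following Proposition 4.7): for `β ≥ 0`, `J ≥ 0` and
all sites `x, y, z, t`,
`|U₄^β(x,y,z,t)| ≤ 2 ∑_{u∈ℤ^d} ⟨σ_xσ_u⟩_β⟨σ_yσ_u⟩_β⟨σ_zσ_u⟩_β⟨σ_tσ_u⟩_β` (the sum in `ℝ≥0∞`). Box limit of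
`abs_ursellFour_expectIn_le`. [cite: Panis2023Triviality, §4.2 (tree diagram bound, display after Proposition 4.7)] -/
theorem treeDiagramBound_state (hβ : 0 ≤ β) (hJ : ∀ x y, 0 ≤ J x y) (x y z t : Site d) :
    ENNReal.ofReal |ursellFour J β x y z t| ≤
      2 * ∑' u : Site d, ENNReal.ofReal
        (pairCorrelation J β x u * pairCorrelation J β y u * pairCorrelation J β z u * pairCorrelation J β t u) := by
  -- convergence of the finite-volume Ursell functions along boxes
  have hT : ∀ A : Finset (Site d),
      Tendsto (fun L : ℕ => expectIn J (box d L) β 0 (spinProduct A)) atTop (𝓝 (state J β 0 (spinProduct A))) :=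
    fun A => tendsto_expectIn_box J β hβ hJ A
  have hlim : Tendsto (fun L : ℕ =>
      expectIn J (box d L) β 0 (spinProduct ({x} ∆ ({y} ∆ ({z} ∆ {t})))) -
        expectIn J (box d L) β 0 (spinProduct ({x} ∆ {y})) * expectIn J (box d L) β 0 (spinProduct ({z} ∆ {t})) -
        expectIn J (box d L) β 0 (spinProduct ({x} ∆ {z})) * expectIn J (box d L) β 0 (spinProduct ({y} ∆ {t})) -
        expectIn J (box d L) β 0 (spinProduct ({x} ∆ {t})) * expectIn J (box d L) β 0 (spinProduct ({y} ∆ {z})))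
      atTop (𝓝 (ursellFour J β x y z t)) := by
    have h := (((hT ({x} ∆ ({y} ∆ ({z} ∆ {t})))).sub ((hT ({x} ∆ {y})).mul (hT ({z} ∆ {t})))).sub
      ((hT ({x} ∆ {z})).mul (hT ({y} ∆ {t})))).sub ((hT ({x} ∆ {t})).mul (hT ({y} ∆ {z})))
    rw [ursellFour, fourCorrelation_eq, pairCorrelation_eq, pairCorrelation_eq, pairCorrelation_eq,
      pairCorrelation_eq, pairCorrelation_eq, pairCorrelation_eq]
    exact h
  have hlim' := (ENNReal.continuous_ofReal.tendsto _).comp hlim.abs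
  -- the bound in every large box
  obtain ⟨L₀, hL₀⟩ := exists_forall_subset_box d ({x, y, z, t} : Finset (Site d))
  refine le_of_tendsto hlim' (eventually_atTop.2 ⟨L₀, fun L hL => ?_⟩)
  have hsub := hL₀ L hL
  have hx : x ∈ box d L := hsub (Finset.mem_insert_self _ _)
  have hy : y ∈ box d L := hsub (Finset.mem_insert_of_mem (Finset.mem_insert_self _ _))
  have hz : z ∈ box d L := hsub (Finset.mem_insert_of_mem (Finset.mem_insert_of_mem (Finset.mem_insert_self _ _)))
  have ht : t ∈ box d L :=
    hsub (Finset.mem_insert_of_mem (Finset.mem_insert_of_mem (Finset.mem_insert_of_mem (Finset.mem_singleton_self _))))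
  have hfin := abs_ursellFour_expectIn_le J β hβ hJ hx hy hz ht
  -- each finite-volume two-point function is dominated by its (nonnegative) limit
  have hpair : ∀ {a u : Site d}, a ∈ box d L → u ∈ box d L →
      expectIn J (box d L) β 0 (spinProduct ({a} ∆ {u})) ≤ pairCorrelation J β a u := by
    intro a u ha hu
    rw [pairCorrelation_eq]
    refine expectIn_le_state J β hβ hJ fun v hv => ?_
    rw [Finset.mem_symmDiff, Finset.mem_singleton, Finset.mem_singleton] at hv
    rcases hv with ⟨rfl, _⟩ | ⟨rfl, _⟩
    · exact ha
    · exact hu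
  have hnn : ∀ (a u : Site d), 0 ≤ expectIn J (box d L) β 0 (spinProduct ({a} ∆ {u})) :=
    fun a u => expectIn_spinProduct_nonneg J _ β hβ hJ _
  have hpn : ∀ (a u : Site d), 0 ≤ pairCorrelation J β a u := pairCorrelation_nonneg J β hβ hJ
  have hterm : ∀ u ∈ box d L,
      expectIn J (box d L) β 0 (spinProduct ({x} ∆ {u})) * expectIn J (box d L) β 0 (spinProduct ({y} ∆ {u})) *
          expectIn J (box d L) β 0 (spinProduct ({z} ∆ {u})) * expectIn J (box d L) β 0 (spinProduct ({t} ∆ {u})) ≤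
        pairCorrelation J β x u * pairCorrelation J β y u * pairCorrelation J β z u * pairCorrelation J β t u := by
    intro u hu
    refine mul_le_mul (mul_le_mul (mul_le_mul (hpair hx hu) (hpair hy hu) (hnn y u) (hpn x u)) (hpair hz hu)
      (hnn z u) (mul_nonneg (hpn x u) (hpn y u))) (hpair ht hu) (hnn t u) ?_
    exact mul_nonneg (mul_nonneg (hpn x u) (hpn y u)) (hpn z u)
  have hprod : ∀ u : Site d,
      0 ≤ pairCorrelation J β x u * pairCorrelation J β y u * pairCorrelation J β z u * pairCorrelation J β t u :=
    fun u => mul_nonneg (mul_nonneg (mul_nonneg (hpn x u) (hpn y u)) (hpn z u)) (hpn t u)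
  calc ENNReal.ofReal |expectIn J (box d L) β 0 (spinProduct ({x} ∆ ({y} ∆ ({z} ∆ {t})))) -
        expectIn J (box d L) β 0 (spinProduct ({x} ∆ {y})) * expectIn J (box d L) β 0 (spinProduct ({z} ∆ {t})) -
        expectIn J (box d L) β 0 (spinProduct ({x} ∆ {z})) * expectIn J (box d L) β 0 (spinProduct ({y} ∆ {t})) -
        expectIn J (box d L) β 0 (spinProduct ({x} ∆ {t})) * expectIn J (box d L) β 0 (spinProduct ({y} ∆ {z}))|
      ≤ ENNReal.ofReal (2 * ∑ u ∈ box d L,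
          pairCorrelation J β x u * pairCorrelation J β y u * pairCorrelation J β z u * pairCorrelation J β t u) :=
        ENNReal.ofReal_le_ofReal (hfin.trans (mul_le_mul_of_nonneg_left (Finset.sum_le_sum hterm) (by norm_num)))
    _ = 2 * ∑ u ∈ box d L, ENNReal.ofReal
          (pairCorrelation J β x u * pairCorrelation J β y u * pairCorrelation J β z u * pairCorrelation J β t u) := by
        rw [ENNReal.ofReal_mul (by norm_num), ENNReal.ofReal_ofNat, ENNReal.ofReal_sum_of_nonneg fun u _ => hprod u]
    _ ≤ 2 * ∑' u : Site d, ENNReal.ofReal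
          (pairCorrelation J β x u * pairCorrelation J β y u * pairCorrelation J β z u * pairCorrelation J β t u) :=
        mul_le_mul' le_rfl (ENNReal.sum_le_tsum _)

end LongRangeIsing

open LongRangeIsing

/-- **Discharge of the named fact `panis_treeDiagramBound`** (Panis 2023, §4.2, the tree diagram bound of
Aizenman 1982, display following Proposition 4.7:
`|U₄^β(x,y,z,t)| ≤ 2 ∑_{u∈ℤ^d} ⟨σ_xσ_u⟩_β ⟨σ_yσ_u⟩_β ⟨σ_zσ_u⟩_β ⟨σ_tσ_u⟩_β`), for the couplings
`J_{x,y} = C₀|x-y|₁^{-d-α}` (`C₀, α > 0`) and `0 < β ≤ β_c` as vendored — in fact for every `J ≥ 0` and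
`β ≥ 0` (`LongRangeIsing.treeDiagramBound_state`), by weighted random currents.
[cite: Panis2023Triviality, §4.2 (tree diagram bound, display following Proposition 4.7)] -/
theorem panis_treeDiagramBound_holds : panis_treeDiagramBound := by
  intro d _ C₀ α hC₀ _ β hβ _ x y z t
  exact treeDiagramBound_state (algebraicCoupling d C₀ α) β hβ.le (algebraicCoupling_nonneg hC₀.le α) x y z t

end Literature.Barriers.CriticalPhenomena

end
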